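import Mathlib.MeasureTheory.Integral.IntegralEqImproper
import Mathlib.MeasureTheory.Integral.ExpDecay
import Mathlib.MeasureTheory.Measure.Haar.NormedSpace
import Mathlib.MeasureTheory.Group.Integral
import Mathlib.Analysis.SpecialFunctions.ImproperIntegrals
import Mathlib.Analysis.SpecialFunctions.Integrals.Basic
import Mathlib.Analysis.Fourier.Inversion
import Literature.Analysis.SpecialFunctions.GammaProductBounds
import HarnessLib

/-!
# Pólya positivity and total mass of the cosine transform of the Fermi function

For `c > 0` let `φ_c(ω) = 1/(1 + e^{cω})` (the Fermi, or logistic, function) and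
`u(c, x) = ∫₀^∞ cos(ωx) φ_c(ω) dω` (`fermiCos c x`). This file proves

* `fermiCos_eq_polya`: `u(c, x) = x⁻² ∫₀^∞ (1 - cos ωx) φ_c''(ω) dω` for `x ≠ 0` (two integrations
  by parts; the boundary terms vanish because `sin 0 = 0`, `1 - cos 0 = 0`, `φ_c, φ_c' → 0`);
* `fermiCos_nonneg`: **`u(c, x) ≥ 0`** for all `x` — Pólya's criterion: `φ_c` is convex and
  decreasing on `(0, ∞)` (`fermiFnDeriv2_nonneg`: `φ_c'' = c² eᶜʷ(eᶜʷ - 1)/(1 + eᶜʷ)³ ≥ 0`);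
* `fermiCos_le_div_sq`, `fermiCos_le_inv`: the bounds `u(c, x) ≤ c/(2x²)` (`∫₀^∞ φ_c'' = -φ_c'(0) =
  c/4`) and `u(c, x) ≤ 1/c`, so `u` is integrable;
* `fourier_fermiAbs`: the Fourier transform of the even profile `φ_c(|ω|)` is
  `𝓕(φ_c(|·|))(ξ) = 2 u(c, 2πξ)` (real, by evenness);
* `integral_fermiCos`: **`∫_ℝ u(c, x) dx = π/2 = π φ_c(0)`** (Fourier inversion at the origin,
  `Continuous.fourierInv_fourier_eq`).

## Purpose

`x ↦ π⁻¹ u(U/2, x)` is the integral kernel of Lieb–Wu's operator `Û = K̂²(1 + K̂²)⁻¹` (Fourier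
multiplier `1/(1 + e^{U|ω|/2})`; Lieb–Wu, Physica A 321 (2003) 1, §5, proof of Theorem 1 and
eq. (U)), for which they note "`Û` has a positive kernel" and `‖Û‖ = 1/2`. The two facts proved
here — positivity of the kernel and total mass `π⁻¹ ∫ u = 1/2` (whence `‖Û‖_{Lᵖ → Lᵖ} ≤ 1/2` by
Young's inequality) — are the kernel inputs of the contraction ("bootstrap") argument that closes
the identification step of Goldbaum's thermodynamic limit at half filling, recorded in the module
docstring of `Literature.MathematicalPhysics.QuantumLattice.LiebWuRho0Bounds`.

## References

* G. Pólya, *Remarks on characteristic functions*, Proc. Berkeley Symp. (1949), Theorem 1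
  (convex decreasing `φ` on `(0, ∞)` have nonnegative cosine transforms); here in the concrete
  twice-differentiable form, by parts.
* E. H. Lieb, F. Y. Wu, Physica A 321 (2003) 1–27 = arXiv:cond-mat/0207529, §5 (the operators
  `K̂`, `R̂`, `Û`; "`‖Û‖ = 1/2`").
* Mathlib: `integral_Ioi_mul_deriv_eq_deriv_mul` (parts on `(a, ∞)`),
  `integral_Ioi_of_hasDerivAt_of_tendsto`, `Real.fourier_real_eq_integral_exp_smul`,
  `Continuous.fourierInv_fourier_eq`, `Measure.integral_comp_mul_left`, `integral_neg_eq_self`;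
  `integrable_exp_neg_mul_abs` is reused from `GammaProductBounds`.
-/

noncomputable section

open MeasureTheory Set Filter Real
open scoped Topology FourierTransform

namespace Literature.Analysis.SpecialFunctions

/-- The Fermi (logistic) function `φ_c(ω) = 1/(1 + e^{cω})`. [folklore] -/
def fermiFn (c ω : ℝ) : ℝ := 1 / (1 + Real.exp (c * ω))

/-- Its derivative `φ_c'(ω) = -c e^{cω}/(1 + e^{cω})²`. [folklore] -/
def fermiFnDeriv (c ω : ℝ) : ℝ := -(c * Real.exp (c * ω)) / (1 + Real.exp (c * ω)) ^ 2

/-- Its second derivative `φ_c''(ω) = c² e^{cω}(e^{cω} - 1)/(1 + e^{cω})³`. [folklore] -/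
def fermiFnDeriv2 (c ω : ℝ) : ℝ :=
  c ^ 2 * Real.exp (c * ω) * (Real.exp (c * ω) - 1) / (1 + Real.exp (c * ω)) ^ 3

/-- `φ_c' = fermiFnDeriv c`. [folklore] -/
theorem hasDerivAt_fermiFn (c ω : ℝ) : HasDerivAt (fermiFn c) (fermiFnDeriv c ω) ω := by
  have hE : HasDerivAt (fun ω => 1 + Real.exp (c * ω)) (c * Real.exp (c * ω)) ω := by
    have := ((hasDerivAt_id ω).const_mul c).exp
    simpa [mul_comm] using this.const_add 1
  have hpos : 1 + Real.exp (c * ω) ≠ 0 := by positivity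
  have h := hE.inv hpos
  unfold fermiFn fermiFnDeriv
  simp only [one_div]
  exact h

/-- `φ_c'' = fermiFnDeriv2 c`. [folklore] -/
theorem hasDerivAt_fermiFnDeriv (c ω : ℝ) : HasDerivAt (fermiFnDeriv c) (fermiFnDeriv2 c ω) ω := by
  have hE : HasDerivAt (fun ω => Real.exp (c * ω)) (c * Real.exp (c * ω)) ω := by
    have := ((hasDerivAt_id ω).const_mul c).exp
    simpa [mul_comm] using this
  have hE1 : HasDerivAt (fun ω => 1 + Real.exp (c * ω)) (c * Real.exp (c * ω)) ω := by
    simpa using hE.const_add 1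
  have hpos : (1 + Real.exp (c * ω)) ^ 2 ≠ 0 := by positivity
  have hnum : HasDerivAt (fun ω => -(c * Real.exp (c * ω))) (-(c * (c * Real.exp (c * ω)))) ω :=
    (hE.const_mul c).neg
  have hden : HasDerivAt (fun ω => (1 + Real.exp (c * ω)) ^ 2)
      (2 * (1 + Real.exp (c * ω)) * (c * Real.exp (c * ω))) ω := by
    have := hE1.fun_pow 2
    simpa using this
  have h := hnum.div hden hpos
  unfold fermiFnDeriv fermiFnDeriv2
  refine h.congr_deriv ?_
  have hpos' : 1 + Real.exp (c * ω) ≠ 0 := by positivity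
  field_simp
  ring

/-- `φ_c > 0`. [folklore] -/
theorem fermiFn_pos (c ω : ℝ) : 0 < fermiFn c ω := by unfold fermiFn; positivity

/-- `φ_c(ω) ≤ e^{-cω}`. [folklore] -/
theorem fermiFn_le_exp_neg {c : ℝ} (ω : ℝ) : fermiFn c ω ≤ Real.exp (-(c * ω)) := by
  unfold fermiFn
  rw [div_le_iff₀ (by positivity), Real.exp_neg]
  have hE := Real.exp_pos (c * ω)
  field_simp
  linarith

/-- `|φ_c'(ω)| ≤ c e^{-cω}` for `c ≥ 0`. [folklore] -/
theorem abs_fermiFnDeriv_le {c : ℝ} (hc : 0 ≤ c) (ω : ℝ) : |fermiFnDeriv c ω| ≤ c * Real.exp (-(c * ω)) := by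
  unfold fermiFnDeriv
  have hE := Real.exp_pos (c * ω)
  rw [abs_div, abs_neg, abs_of_nonneg (by positivity), abs_of_pos (by positivity),
    div_le_iff₀ (by positivity), Real.exp_neg]
  field_simp
  nlinarith [hE, sq_nonneg (Real.exp (c * ω))]

/-- **Convexity of the Fermi function on `[0, ∞)`**: `φ_c''(ω) ≥ 0` where `cω ≥ 0`. [folklore] -/
theorem fermiFnDeriv2_nonneg {c ω : ℝ} (hω : 0 ≤ c * ω) : 0 ≤ fermiFnDeriv2 c ω := by
  unfold fermiFnDeriv2
  have : 1 ≤ Real.exp (c * ω) := Real.one_le_exp hω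
  have : 0 ≤ Real.exp (c * ω) - 1 := by linarith
  positivity

/-- `|φ_c''(ω)| ≤ c² e^{-cω}`. [folklore] -/
theorem abs_fermiFnDeriv2_le {c : ℝ} (ω : ℝ) : |fermiFnDeriv2 c ω| ≤ c ^ 2 * Real.exp (-(c * ω)) := by
  unfold fermiFnDeriv2
  have hE := Real.exp_pos (c * ω)
  set E := Real.exp (c * ω) with hEdef
  rw [abs_div, abs_of_pos (by positivity : (0:ℝ) < (1 + E) ^ 3), div_le_iff₀ (by positivity),
    Real.exp_neg, ← hEdef]
  rw [abs_mul, abs_mul, abs_of_nonneg (sq_nonneg c), abs_of_pos hE]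
  have h1 : |E - 1| ≤ E + 1 := by
    rw [abs_le]; constructor <;> linarith
  have hE0 : E ≠ 0 := hE.ne'
  calc c ^ 2 * E * |E - 1| ≤ c ^ 2 * E * (E + 1) := by gcongr
    _ ≤ c ^ 2 * E⁻¹ * (1 + E) ^ 3 := by
        rw [mul_assoc, mul_assoc]
        refine mul_le_mul_of_nonneg_left ?_ (sq_nonneg c)
        rw [← sub_nonneg]
        have : E⁻¹ * (1 + E) ^ 3 - E * (E + 1) = E⁻¹ * (1 + E) * (1 + 2 * E) := by
          field_simp
          ring
        rw [this]
        positivity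



/-- `u(c, x) = ∫₀^∞ cos(ωx) φ_c(ω) dω`, the cosine transform of the Fermi function. [folklore] -/
def fermiCos (c x : ℝ) : ℝ := ∫ ω in Ioi (0 : ℝ), Real.cos (ω * x) * fermiFn c ω

/-- Continuity of `φ_c`. [folklore] -/
theorem continuous_fermiFn (c : ℝ) : Continuous (fermiFn c) := by
  unfold fermiFn
  exact Continuous.div continuous_const (by fun_prop) fun ω => by positivity

/-- Continuity of `φ_c'`. [folklore] -/
theorem continuous_fermiFnDeriv (c : ℝ) : Continuous (fermiFnDeriv c) := by
  unfold fermiFnDeriv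
  exact Continuous.div (by fun_prop) (by fun_prop) fun ω => by positivity

/-- Continuity of `φ_c''`. [folklore] -/
theorem continuous_fermiFnDeriv2 (c : ℝ) : Continuous (fermiFnDeriv2 c) := by
  unfold fermiFnDeriv2
  exact Continuous.div (by fun_prop) (by fun_prop) fun ω => by positivity

/-- Integrability of `cos(ωx) φ(ω)` on `(0, ∞)`. [folklore] -/
theorem integrableOn_cos_mul_fermiFn {c : ℝ} (hc : 0 < c) (x : ℝ) :
    IntegrableOn (fun ω => Real.cos (ω * x) * fermiFn c ω) (Ioi 0) := by
  refine Integrable.mono' (exp_neg_integrableOn_Ioi 0 hc)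
    ((by fun_prop : Continuous fun ω => Real.cos (ω * x)).mul (continuous_fermiFn c)).aestronglyMeasurable
    (Eventually.of_forall fun ω => ?_)
  rw [Real.norm_eq_abs, abs_mul, neg_mul]
  calc |Real.cos (ω * x)| * |fermiFn c ω| ≤ 1 * Real.exp (-(c * ω)) := by
        refine mul_le_mul (Real.abs_cos_le_one _) ?_ (abs_nonneg _) zero_le_one
        rw [abs_of_pos (fermiFn_pos c ω)]
        exact fermiFn_le_exp_neg ω
    _ = Real.exp (-(c * ω)) := one_mul _

/-- **Pólya's integration by parts, first step**:
`∫₀^∞ cos(ωx) φ(ω) dω = -x⁻¹ ∫₀^∞ sin(ωx) φ'(ω) dω` for `x ≠ 0`. [folklore] -/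
theorem fermiCos_eq_step1 {c x : ℝ} (hc : 0 < c) (hx : x ≠ 0) :
    fermiCos c x = -(x⁻¹ * ∫ ω in Ioi (0 : ℝ), Real.sin (ω * x) * fermiFnDeriv c ω) := by
  -- parts with `u = φ`, `v = sin(ωx)/x`
  have hv : ∀ ω ∈ Ioi (0 : ℝ), HasDerivAt (fun ω => Real.sin (ω * x) / x) (Real.cos (ω * x)) ω := by
    intro ω _
    have h := ((hasDerivAt_id ω).mul_const x).sin.div_const x
    simp only [id, one_mul] at h
    exact h.congr_deriv (by rw [mul_div_assoc, div_self hx, mul_one])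
  have hu : ∀ ω ∈ Ioi (0 : ℝ), HasDerivAt (fermiFn c) (fermiFnDeriv c ω) ω := fun ω _ =>
    hasDerivAt_fermiFn c ω
  have huv' : IntegrableOn ((fermiFn c) * fun ω => Real.cos (ω * x)) (Ioi 0) := by
    have := integrableOn_cos_mul_fermiFn hc x
    refine this.congr (Eventually.of_forall fun ω => ?_)
    simp [mul_comm]
  have hu'v : IntegrableOn ((fermiFnDeriv c) * fun ω => Real.sin (ω * x) / x) (Ioi 0) := by
    refine Integrable.mono' ((exp_neg_integrableOn_Ioi 0 hc).const_mul (c * |x|⁻¹))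
      ((continuous_fermiFnDeriv c).mul (by fun_prop)).aestronglyMeasurable
      (Eventually.of_forall fun ω => ?_)
    simp only [Pi.mul_apply, Real.norm_eq_abs, abs_mul, abs_div, neg_mul]
    have h1 := abs_fermiFnDeriv_le hc.le ω
    have h2 := Real.abs_sin_le_one (ω * x)
    have hx' : 0 < |x| := abs_pos.2 hx
    calc |fermiFnDeriv c ω| * (|Real.sin (ω * x)| / |x|) ≤ c * Real.exp (-(c * ω)) * (1 / |x|) := by
          gcongr
      _ = c * |x|⁻¹ * Real.exp (-(c * ω)) := by ring
  have h_zero : Tendsto ((fermiFn c) * fun ω => Real.sin (ω * x) / x) (𝓝[>] 0) (𝓝 0) := by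
    have hcont : Continuous ((fermiFn c) * fun ω => Real.sin (ω * x) / x) :=
      (continuous_fermiFn c).mul (by fun_prop)
    have := hcont.tendsto 0
    simp only [Pi.mul_apply, zero_mul, Real.sin_zero, zero_div, mul_zero] at this
    exact this.mono_left nhdsWithin_le_nhds
  have h_infty : Tendsto ((fermiFn c) * fun ω => Real.sin (ω * x) / x) atTop (𝓝 0) := by
    have hexp : Tendsto (fun ω => Real.exp (-(c * ω)) * |x|⁻¹) atTop (𝓝 (0 * |x|⁻¹)) := by
      refine Tendsto.mul_const _ ?_
      have h1 : Tendsto (fun ω => c * ω) atTop atTop := tendsto_id.const_mul_atTop hc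
      exact tendsto_exp_neg_atTop_nhds_zero.comp h1
    rw [zero_mul] at hexp
    refine squeeze_zero_norm (fun ω => ?_) hexp
    simp only [Pi.mul_apply, Real.norm_eq_abs, abs_mul, abs_div]
    have h1 := Real.abs_sin_le_one (ω * x)
    have hx' : 0 < |x| := abs_pos.2 hx
    rw [abs_of_pos (fermiFn_pos c ω)]
    calc fermiFn c ω * (|Real.sin (ω * x)| / |x|) ≤ Real.exp (-(c * ω)) * (1 / |x|) := by
          gcongr
          exact fermiFn_le_exp_neg ω
      _ = Real.exp (-(c * ω)) * |x|⁻¹ := by ring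
  have hparts := integral_Ioi_mul_deriv_eq_deriv_mul hu hv huv' hu'v h_zero h_infty
  unfold fermiCos
  rw [show (fun ω => Real.cos (ω * x) * fermiFn c ω) = fun ω => fermiFn c ω * Real.cos (ω * x) from
    funext fun ω => mul_comm _ _, hparts, ← integral_const_mul]
  simp only [sub_zero, zero_sub, neg_inj]
  refine integral_congr_ae (Eventually.of_forall fun ω => ?_)
  simp only
  field_simp



/-- **Pólya's integration by parts, second step**:
`∫₀^∞ sin(ωx) φ'(ω) dω = -x⁻¹ ∫₀^∞ (1 - cos(ωx)) φ''(ω) dω` for `x ≠ 0`. [folklore] -/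
theorem integral_sin_mul_fermiFnDeriv {c x : ℝ} (hc : 0 < c) (hx : x ≠ 0) :
    ∫ ω in Ioi (0 : ℝ), Real.sin (ω * x) * fermiFnDeriv c ω =
      -(x⁻¹ * ∫ ω in Ioi (0 : ℝ), (1 - Real.cos (ω * x)) * fermiFnDeriv2 c ω) := by
  have hv : ∀ ω ∈ Ioi (0 : ℝ), HasDerivAt (fun ω => (1 - Real.cos (ω * x)) / x) (Real.sin (ω * x)) ω := by
    intro ω _
    have h := (((hasDerivAt_id ω).mul_const x).cos.const_sub 1).div_const x
    simp only [id, one_mul] at h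
    exact h.congr_deriv (by rw [neg_mul, neg_neg, mul_div_assoc, div_self hx, mul_one])
  have hu : ∀ ω ∈ Ioi (0 : ℝ), HasDerivAt (fermiFnDeriv c) (fermiFnDeriv2 c ω) ω := fun ω _ =>
    hasDerivAt_fermiFnDeriv c ω
  have huv' : IntegrableOn ((fermiFnDeriv c) * fun ω => Real.sin (ω * x)) (Ioi 0) := by
    refine Integrable.mono' ((exp_neg_integrableOn_Ioi 0 hc).const_mul c)
      ((continuous_fermiFnDeriv c).mul (by fun_prop)).aestronglyMeasurable
      (Eventually.of_forall fun ω => ?_)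
    simp only [Pi.mul_apply, Real.norm_eq_abs, abs_mul, neg_mul]
    have h1 := abs_fermiFnDeriv_le hc.le ω
    have h2 := Real.abs_sin_le_one (ω * x)
    calc |fermiFnDeriv c ω| * |Real.sin (ω * x)| ≤ c * Real.exp (-(c * ω)) * 1 := by gcongr
      _ = c * Real.exp (-(c * ω)) := mul_one _
  have hu'v : IntegrableOn ((fermiFnDeriv2 c) * fun ω => (1 - Real.cos (ω * x)) / x) (Ioi 0) := by
    refine Integrable.mono' ((exp_neg_integrableOn_Ioi 0 hc).const_mul (c ^ 2 * (2 / |x|)))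
      ((continuous_fermiFnDeriv2 c).mul (by fun_prop)).aestronglyMeasurable
      (Eventually.of_forall fun ω => ?_)
    simp only [Pi.mul_apply, Real.norm_eq_abs, abs_mul, abs_div, neg_mul]
    have h1 := abs_fermiFnDeriv2_le (c := c) ω
    have h2 : |1 - Real.cos (ω * x)| ≤ 2 := by
      have := Real.abs_cos_le_one (ω * x)
      rw [abs_le] at this ⊢
      constructor <;> linarith
    have hx' : 0 < |x| := abs_pos.2 hx
    calc |fermiFnDeriv2 c ω| * (|1 - Real.cos (ω * x)| / |x|) ≤ c ^ 2 * Real.exp (-(c * ω)) * (2 / |x|) := by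
          gcongr
      _ = c ^ 2 * (2 / |x|) * Real.exp (-(c * ω)) := by ring
  have h_zero : Tendsto ((fermiFnDeriv c) * fun ω => (1 - Real.cos (ω * x)) / x) (𝓝[>] 0) (𝓝 0) := by
    have hcont : Continuous ((fermiFnDeriv c) * fun ω => (1 - Real.cos (ω * x)) / x) :=
      (continuous_fermiFnDeriv c).mul (by fun_prop)
    have := hcont.tendsto 0
    simp only [Pi.mul_apply, zero_mul, Real.cos_zero, sub_self, zero_div, mul_zero] at this
    exact this.mono_left nhdsWithin_le_nhds
  have h_infty : Tendsto ((fermiFnDeriv c) * fun ω => (1 - Real.cos (ω * x)) / x) atTop (𝓝 0) := by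
    have hexp : Tendsto (fun ω => c * Real.exp (-(c * ω)) * (2 / |x|)) atTop (𝓝 (c * 0 * (2 / |x|))) := by
      refine (Tendsto.const_mul c ?_).mul_const _
      have h1 : Tendsto (fun ω => c * ω) atTop atTop := tendsto_id.const_mul_atTop hc
      exact tendsto_exp_neg_atTop_nhds_zero.comp h1
    rw [mul_zero, zero_mul] at hexp
    refine squeeze_zero_norm (fun ω => ?_) hexp
    simp only [Pi.mul_apply, Real.norm_eq_abs, abs_mul, abs_div]
    have h1 := abs_fermiFnDeriv_le hc.le ω
    have h2 : |1 - Real.cos (ω * x)| ≤ 2 := by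
      have := Real.abs_cos_le_one (ω * x)
      rw [abs_le] at this ⊢
      constructor <;> linarith
    have hx' : 0 < |x| := abs_pos.2 hx
    calc |fermiFnDeriv c ω| * (|1 - Real.cos (ω * x)| / |x|) ≤ c * Real.exp (-(c * ω)) * (2 / |x|) := by
          gcongr
      _ = c * Real.exp (-(c * ω)) * (2 / |x|) := rfl
  have hparts := integral_Ioi_mul_deriv_eq_deriv_mul hu hv huv' hu'v h_zero h_infty
  rw [show (fun ω => Real.sin (ω * x) * fermiFnDeriv c ω) = fun ω => fermiFnDeriv c ω * Real.sin (ω * x)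
    from funext fun ω => mul_comm _ _, hparts, ← integral_const_mul]
  simp only [sub_zero, zero_sub, neg_inj]
  refine integral_congr_ae (Eventually.of_forall fun ω => ?_)
  simp only
  field_simp

/-- **Pólya's formula**: for `x ≠ 0`,
`∫₀^∞ cos(ωx) φ(ω) dω = x⁻² ∫₀^∞ (1 - cos(ωx)) φ''(ω) dω`. [folklore] -/
theorem fermiCos_eq_polya {c x : ℝ} (hc : 0 < c) (hx : x ≠ 0) :
    fermiCos c x = x⁻¹ ^ 2 * ∫ ω in Ioi (0 : ℝ), (1 - Real.cos (ω * x)) * fermiFnDeriv2 c ω := by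
  rw [fermiCos_eq_step1 hc hx, integral_sin_mul_fermiFnDeriv hc hx]
  ring

/-- **Positivity (Pólya's criterion)**: the cosine transform of the convex, decreasing Fermi function
is nonnegative. [folklore] -/
theorem fermiCos_nonneg {c : ℝ} (hc : 0 < c) (x : ℝ) : 0 ≤ fermiCos c x := by
  rcases eq_or_ne x 0 with rfl | hx
  · unfold fermiCos
    refine setIntegral_nonneg measurableSet_Ioi fun ω _ => ?_
    simp only [mul_zero, Real.cos_zero, one_mul]
    exact (fermiFn_pos c ω).le
  · rw [fermiCos_eq_polya hc hx]
    refine mul_nonneg (sq_nonneg _) (setIntegral_nonneg measurableSet_Ioi fun ω hω => ?_)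
    refine mul_nonneg ?_ (fermiFnDeriv2_nonneg ?_)
    · linarith [Real.cos_le_one (ω * x)]
    · exact (mul_pos hc hω).le

/-- `∫₀^∞ φ''(ω) dω = -φ'(0) = c/4`. [folklore] -/
theorem integral_fermiFnDeriv2 {c : ℝ} (hc : 0 < c) : ∫ ω in Ioi (0 : ℝ), fermiFnDeriv2 c ω = c / 4 := by
  have hint : IntegrableOn (fermiFnDeriv2 c) (Ioi 0) := by
    refine Integrable.mono' ((exp_neg_integrableOn_Ioi 0 hc).const_mul (c ^ 2))
      (continuous_fermiFnDeriv2 c).aestronglyMeasurable (Eventually.of_forall fun ω => ?_)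
    rw [Real.norm_eq_abs, neg_mul]
    exact abs_fermiFnDeriv2_le ω
  have hlim : Tendsto (fermiFnDeriv c) atTop (𝓝 0) := by
    have hexp : Tendsto (fun ω => c * Real.exp (-(c * ω))) atTop (𝓝 (c * 0)) := by
      refine Tendsto.const_mul c ?_
      have h1 : Tendsto (fun ω => c * ω) atTop atTop := tendsto_id.const_mul_atTop hc
      exact tendsto_exp_neg_atTop_nhds_zero.comp h1
    rw [mul_zero] at hexp
    exact squeeze_zero_norm (fun ω => by rw [Real.norm_eq_abs]; exact abs_fermiFnDeriv_le hc.le ω) hexp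
  rw [integral_Ioi_of_hasDerivAt_of_tendsto (continuous_fermiFnDeriv c).continuousWithinAt
    (fun ω _ => hasDerivAt_fermiFnDeriv c ω) hint hlim]
  unfold fermiFnDeriv
  simp
  norm_num
  ring

/-- **Decay**: `u(c, x) ≤ c/(2x²)` for `x ≠ 0`. [folklore] -/
theorem fermiCos_le_div_sq {c x : ℝ} (hc : 0 < c) (hx : x ≠ 0) : fermiCos c x ≤ c / (2 * x ^ 2) := by
  rw [fermiCos_eq_polya hc hx]
  have hint : IntegrableOn (fermiFnDeriv2 c) (Ioi 0) := by
    refine Integrable.mono' ((exp_neg_integrableOn_Ioi 0 hc).const_mul (c ^ 2))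
      (continuous_fermiFnDeriv2 c).aestronglyMeasurable (Eventually.of_forall fun ω => ?_)
    rw [Real.norm_eq_abs, neg_mul]
    exact abs_fermiFnDeriv2_le ω
  have hle : ∫ ω in Ioi (0 : ℝ), (1 - Real.cos (ω * x)) * fermiFnDeriv2 c ω ≤
      ∫ ω in Ioi (0 : ℝ), 2 * fermiFnDeriv2 c ω := by
    refine setIntegral_mono_on ?_ (hint.const_mul 2) measurableSet_Ioi fun ω hω => ?_
    · refine Integrable.mono' (hint.const_mul 2)
        ((by fun_prop : Continuous fun ω => 1 - Real.cos (ω * x)).mul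
          (continuous_fermiFnDeriv2 c)).aestronglyMeasurable ?_
      filter_upwards [ae_restrict_mem measurableSet_Ioi] with ω hω
      rw [Real.norm_eq_abs, abs_mul, abs_of_nonneg (fermiFnDeriv2_nonneg (mul_pos hc hω).le)]
      refine mul_le_mul_of_nonneg_right ?_ (fermiFnDeriv2_nonneg (mul_pos hc hω).le)
      have := Real.abs_cos_le_one (ω * x)
      rw [abs_le] at this ⊢
      constructor <;> linarith
    · refine mul_le_mul_of_nonneg_right ?_ (fermiFnDeriv2_nonneg (mul_pos hc hω).le)
      linarith [Real.neg_one_le_cos (ω * x)]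
  rw [integral_const_mul, integral_fermiFnDeriv2 hc] at hle
  have hx2 : 0 < x ^ 2 := by positivity
  calc x⁻¹ ^ 2 * ∫ ω in Ioi (0 : ℝ), (1 - Real.cos (ω * x)) * fermiFnDeriv2 c ω
      ≤ x⁻¹ ^ 2 * (2 * (c / 4)) := by gcongr
    _ = c / (2 * x ^ 2) := by field_simp; ring

/-- **Boundedness**: `u(c, x) ≤ 1/c`. [folklore] -/
theorem fermiCos_le_inv {c : ℝ} (hc : 0 < c) (x : ℝ) : fermiCos c x ≤ 1 / c := by
  unfold fermiCos
  have h1 : ∫ ω in Ioi (0 : ℝ), Real.cos (ω * x) * fermiFn c ω ≤ ∫ ω in Ioi (0 : ℝ), Real.exp (-(c * ω)) := by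
    refine setIntegral_mono_on (integrableOn_cos_mul_fermiFn hc x) ?_ measurableSet_Ioi fun ω _ => ?_
    · exact (exp_neg_integrableOn_Ioi 0 hc).congr (Eventually.of_forall fun ω => by simp [neg_mul])
    · calc Real.cos (ω * x) * fermiFn c ω ≤ 1 * fermiFn c ω :=
            mul_le_mul_of_nonneg_right (Real.cos_le_one _) (fermiFn_pos c ω).le
        _ ≤ Real.exp (-(c * ω)) := by rw [one_mul]; exact fermiFn_le_exp_neg ω
  have h2 : ∫ ω in Ioi (0 : ℝ), Real.exp (-(c * ω)) = 1 / c := by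
    have := integral_exp_mul_Ioi (neg_lt_zero.2 hc) 0
    simp only [mul_zero, Real.exp_zero] at this
    rw [show (fun ω => Real.exp (-(c * ω))) = fun ω => Real.exp (-c * ω) from
      funext fun ω => by rw [neg_mul], this]
    field_simp
  linarith




/-- The even extension `ω ↦ φ_c(|ω|)`, complex-valued. [folklore] -/
def fermiAbs (c : ℝ) : ℝ → ℂ := fun ω => (fermiFn c |ω| : ℂ)

/-- Continuity of `ω ↦ φ_c(|ω|)`. [folklore] -/
theorem continuous_fermiAbs (c : ℝ) : Continuous (fermiAbs c) :=
  Complex.continuous_ofReal.comp ((continuous_fermiFn c).comp continuous_abs)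

/-- `ω ↦ φ_c(|ω|)` is integrable for `c > 0`. [folklore] -/
theorem integrable_fermiAbs {c : ℝ} (hc : 0 < c) : Integrable (fermiAbs c) := by
  refine Integrable.mono' (integrable_exp_neg_mul_abs hc) (continuous_fermiAbs c).aestronglyMeasurable
    (Eventually.of_forall fun ω => ?_)
  rw [fermiAbs, Complex.norm_real, Real.norm_eq_abs, abs_of_pos (fermiFn_pos c _)]
  exact fermiFn_le_exp_neg |ω|

/-- The real part of the Fourier integrand integrates to `2 u(c, 2πξ)` (evenness). [folklore] -/
theorem integral_fermiFn_abs_mul_cos {c : ℝ} (hc : 0 < c) (ξ : ℝ) :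
    ∫ v : ℝ, fermiFn c |v| * Real.cos (2 * π * v * ξ) = 2 * fermiCos c (2 * π * ξ) := by
  set A : ℝ → ℝ := fun v => fermiFn c |v| * Real.cos (2 * π * v * ξ) with hA
  have hAi : Integrable A := by
    refine Integrable.mono' (integrable_exp_neg_mul_abs hc)
      (((continuous_fermiFn c).comp continuous_abs).mul (by fun_prop)).aestronglyMeasurable
      (Eventually.of_forall fun v => ?_)
    simp only [hA, Real.norm_eq_abs, abs_mul, abs_of_pos (fermiFn_pos c _)]
    calc fermiFn c |v| * |Real.cos (2 * π * v * ξ)| ≤ Real.exp (-(c * |v|)) * 1 :=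
          mul_le_mul (fermiFn_le_exp_neg |v|) (Real.abs_cos_le_one _) (abs_nonneg _) (Real.exp_pos _).le
      _ = Real.exp (-(c * |v|)) := mul_one _
  have hsplit := integral_add_compl (measurableSet_Ioi (a := (0 : ℝ))) hAi
  rw [← hsplit, compl_Ioi]
  have hneg : ∫ v in Iic (0:ℝ), A v = ∫ v in Ioi (0:ℝ), A v := by
    rw [← neg_zero, ← integral_comp_neg_Ioi (f := A)]
    simp only [neg_zero]
    refine setIntegral_congr_fun measurableSet_Ioi fun v _ => ?_
    simp only [hA, abs_neg]
    rw [show 2 * π * -v * ξ = -(2 * π * v * ξ) by ring, Real.cos_neg]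
  rw [hneg, ← two_mul, fermiCos]
  congr 1
  refine setIntegral_congr_fun measurableSet_Ioi fun v hv => ?_
  simp only [hA, abs_of_pos (show (0:ℝ) < v from hv)]
  rw [mul_comm, show 2 * π * v * ξ = v * (2 * π * ξ) by ring]

/-- The imaginary part of the Fourier integrand integrates to zero (oddness). [folklore] -/
theorem integral_fermiFn_abs_mul_sin {c : ℝ} (ξ : ℝ) :
    ∫ v : ℝ, fermiFn c |v| * Real.sin (2 * π * v * ξ) = 0 := by
  set B : ℝ → ℝ := fun v => fermiFn c |v| * Real.sin (2 * π * v * ξ) with hB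
  have h1 : ∫ v, B v = ∫ v, B (-v) := (integral_neg_eq_self B volume).symm
  have h2 : (fun v => B (-v)) = fun v => -B v := by
    funext v
    simp only [hB, abs_neg]
    rw [show 2 * π * -v * ξ = -(2 * π * v * ξ) by ring, Real.sin_neg]
    ring
  rw [h2, integral_neg] at h1
  linarith

/-- **Fourier transform of the even Fermi profile**: `𝓕(φ_c(|·|))(ξ) = 2 u(c, 2πξ)`. [folklore] -/
theorem fourier_fermiAbs {c : ℝ} (hc : 0 < c) (ξ : ℝ) :
    𝓕 (fermiAbs c) ξ = ((2 * fermiCos c (2 * π * ξ) : ℝ) : ℂ) := by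
  rw [Real.fourier_real_eq_integral_exp_smul]
  have hsplit : (fun v : ℝ => Complex.exp (↑(-2 * π * v * ξ) * Complex.I) • fermiAbs c v) =
      fun v => ((fermiFn c |v| * Real.cos (2 * π * v * ξ) : ℝ) : ℂ) +
        ((-(fermiFn c |v| * Real.sin (2 * π * v * ξ)) : ℝ) : ℂ) * Complex.I := by
    funext v
    simp only [fermiAbs, smul_eq_mul]
    rw [Complex.exp_mul_I, ← Complex.ofReal_cos, ← Complex.ofReal_sin]
    have : (-2 * π * v * ξ : ℝ) = -(2 * π * v * ξ) := by ring
    rw [this, Real.cos_neg, Real.sin_neg]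
    push_cast
    ring
  rw [hsplit]
  have hi1 : Integrable fun v : ℝ => ((fermiFn c |v| * Real.cos (2 * π * v * ξ) : ℝ) : ℂ) := by
    have hcf := continuous_fermiFn c
    refine (Integrable.mono' (integrable_exp_neg_mul_abs hc)
      (by fun_prop : Continuous fun v => fermiFn c |v| * Real.cos (2 * π * v * ξ)).aestronglyMeasurable
      (Eventually.of_forall fun v => ?_)).ofReal
    simp only [Real.norm_eq_abs, abs_mul, abs_of_pos (fermiFn_pos c _)]
    calc fermiFn c |v| * |Real.cos (2 * π * v * ξ)| ≤ Real.exp (-(c * |v|)) * 1 :=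
          mul_le_mul (fermiFn_le_exp_neg |v|) (Real.abs_cos_le_one _) (abs_nonneg _) (Real.exp_pos _).le
      _ = Real.exp (-(c * |v|)) := mul_one _
  have hi2 : Integrable fun v : ℝ => ((-(fermiFn c |v| * Real.sin (2 * π * v * ξ)) : ℝ) : ℂ) * Complex.I := by
    refine (Integrable.ofReal ?_).mul_const _
    have hcf := continuous_fermiFn c
    refine (Integrable.mono' (integrable_exp_neg_mul_abs hc)
      (by fun_prop : Continuous fun v => fermiFn c |v| * Real.sin (2 * π * v * ξ)).aestronglyMeasurable
      (Eventually.of_forall fun v => ?_)).neg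
    simp only [Real.norm_eq_abs, abs_mul, abs_of_pos (fermiFn_pos c _)]
    calc fermiFn c |v| * |Real.sin (2 * π * v * ξ)| ≤ Real.exp (-(c * |v|)) * 1 :=
          mul_le_mul (fermiFn_le_exp_neg |v|) (Real.abs_sin_le_one _) (abs_nonneg _) (Real.exp_pos _).le
      _ = Real.exp (-(c * |v|)) := mul_one _
  rw [integral_add hi1 hi2, integral_mul_const, integral_complex_ofReal, integral_complex_ofReal,
    integral_neg, integral_fermiFn_abs_mul_cos hc, integral_fermiFn_abs_mul_sin]
  simp

/-- A uniform decay bound: `u(c, 2πξ) ≤ (1/c + c/(8π²))/(1 + ξ²)`. [folklore] -/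
theorem fermiCos_two_pi_mul_le {c : ℝ} (hc : 0 < c) (ξ : ℝ) :
    fermiCos c (2 * π * ξ) ≤ (1 / c + c / (8 * π ^ 2)) * (1 + ξ ^ 2)⁻¹ := by
  have h1 := fermiCos_le_inv hc (2 * π * ξ)
  have hπ := Real.pi_pos
  rw [le_mul_inv_iff₀ (by positivity)]
  rcases eq_or_ne ξ 0 with rfl | hξ
  · simp only [mul_zero] at h1 ⊢
    have : 0 ≤ c / (8 * π ^ 2) := by positivity
    nlinarith
  · have hx : 2 * π * ξ ≠ 0 := by positivity
    have h2 := fermiCos_le_div_sq hc hx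
    have h3 : ξ ^ 2 * fermiCos c (2 * π * ξ) ≤ c / (8 * π ^ 2) := by
      have hξ2 : 0 < ξ ^ 2 := by positivity
      calc ξ ^ 2 * fermiCos c (2 * π * ξ) ≤ ξ ^ 2 * (c / (2 * (2 * π * ξ) ^ 2)) := by gcongr
        _ = c / (8 * π ^ 2) := by field_simp; ring
    nlinarith [fermiCos_nonneg hc (2 * π * ξ)]

/-- The Fourier transform of the even Fermi profile is integrable. [folklore] -/
theorem integrable_fourier_fermiAbs {c : ℝ} (hc : 0 < c) : Integrable (𝓕 (fermiAbs c)) := by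
  have hcont : Continuous (𝓕 (fermiAbs c)) :=
    VectorFourier.fourierIntegral_continuous Real.continuous_fourierChar (innerSL ℝ).continuous₂
      (integrable_fermiAbs hc)
  refine Integrable.mono' (integrable_inv_one_add_sq.const_mul (2 * (1 / c + c / (8 * π ^ 2))))
    hcont.aestronglyMeasurable (Eventually.of_forall fun ξ => ?_)
  rw [fourier_fermiAbs hc, Complex.norm_real, Real.norm_eq_abs,
    abs_of_nonneg (by have := fermiCos_nonneg hc (2 * π * ξ); positivity)]
  have := fermiCos_two_pi_mul_le hc ξ
  nlinarith

/-- **`∫_ℝ u(c, x) dx = π/2`** (`= π φ_c(0)`; Fourier inversion at the origin). [folklore] -/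
theorem integral_fermiCos {c : ℝ} (hc : 0 < c) : ∫ x : ℝ, fermiCos c x = π / 2 := by
  have hinv := congrFun ((continuous_fermiAbs c).fourierInv_fourier_eq (integrable_fermiAbs hc)
    (integrable_fourier_fermiAbs hc)) 0
  rw [Real.fourierInv_eq'] at hinv
  simp only [inner_zero_right, mul_zero, Complex.ofReal_zero, zero_mul, Complex.exp_zero, one_smul]
    at hinv
  simp_rw [fourier_fermiAbs hc] at hinv
  rw [integral_complex_ofReal, fermiAbs, abs_zero] at hinv
  have hval : fermiFn c 0 = 1 / 2 := by simp [fermiFn]; norm_num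
  rw [hval] at hinv
  have hreal : ∫ ξ : ℝ, 2 * fermiCos c (2 * π * ξ) = 1 / 2 := by exact_mod_cast hinv
  have hsub : ∫ ξ : ℝ, 2 * fermiCos c (2 * π * ξ) = 2 * (|(2 * π)⁻¹| * ∫ x : ℝ, fermiCos c x) := by
    rw [integral_const_mul]
    congr 1
    have := Measure.integral_comp_mul_left (fun x => fermiCos c x) (2 * π)
    simpa using this
  rw [hsub, abs_of_pos (by positivity)] at hreal
  have hπ := Real.pi_pos
  field_simp at hreal
  linarith

/-! ### Continuity and integrability of `u(c, ·)` (from the Fourier representation) -/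

/-- `u(c, ·)` is continuous (it is `ξ ↦ ½ 𝓕(φ_c(|·|))(ξ/2π)`, a Fourier transform of an
integrable function). [folklore] -/
theorem continuous_fermiCos {c : ℝ} (hc : 0 < c) : Continuous (fermiCos c) := by
  have hcont : Continuous (𝓕 (fermiAbs c)) :=
    VectorFourier.fourierIntegral_continuous Real.continuous_fourierChar (innerSL ℝ).continuous₂
      (integrable_fermiAbs hc)
  have h2 : Continuous fun ξ : ℝ => fermiCos c (2 * π * ξ) := by
    have : (fun ξ : ℝ => fermiCos c (2 * π * ξ)) = fun ξ => (𝓕 (fermiAbs c) ξ).re / 2 := by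
      funext ξ
      rw [fourier_fermiAbs hc, Complex.ofReal_re]
      ring
    rw [this]
    exact (Complex.continuous_re.comp hcont).div_const _
  have h3 : (fermiCos c) = (fun ξ : ℝ => fermiCos c (2 * π * ξ)) ∘ fun x => (2 * π)⁻¹ * x := by
    funext x
    simp only [Function.comp_apply]
    congr 1
    field_simp
  rw [h3]
  exact h2.comp (continuous_const.mul continuous_id)

/-- **`u(c, ·)` is integrable on `ℝ`** (`c > 0`): its rescaling `ξ ↦ 2u(c, 2πξ) = 𝓕(φ_c(|·|))(ξ)`
is integrable (`integrable_fourier_fermiAbs`). [folklore] -/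
theorem integrable_fermiCos {c : ℝ} (hc : 0 < c) : Integrable (fermiCos c) := by
  have h1 : Integrable fun ξ : ℝ => 2 * fermiCos c (2 * π * ξ) := by
    refine (integrable_fourier_fermiAbs hc).norm.congr (Eventually.of_forall fun ξ => ?_)
    simp only
    rw [fourier_fermiAbs hc, Complex.norm_real, Real.norm_eq_abs,
      abs_of_nonneg (by have := fermiCos_nonneg hc (2 * π * ξ); positivity)]
  have h2 : Integrable fun ξ : ℝ => fermiCos c (2 * π * ξ) := by
    have := h1.const_mul (1 / 2)
    refine this.congr (Eventually.of_forall fun ξ => ?_)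
    simp only
    ring
  exact (integrable_comp_mul_left_iff (fermiCos c) (by positivity : (2 * π : ℝ) ≠ 0)).1 h2

end Literature.Analysis.SpecialFunctions
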